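import Summits.RiemannHypothesis.RiemannHypothesis.Theorems.UniversalFactorLaplaceLoopholeInterlacing

/-!
# RiemannHypothesis / UniversalFactor — the sign criterion against the loophole

Route `RiemannHypothesis/UniversalFactor`, target `LaplaceLoophole` (stmt-RiemannHypothesis-2575). The
consumable form of `UniversalFactor.not_three_zeros_of_zeroFree`
(`UniversalFactorLaplaceLoopholeInterlacing.lean`) for the certified computations of the medium window
(`MediumKernelNoGo`, `LehmerPointNoGo`) and for the band-limit argument of the narrow window
(`NarrowKernelNoGo`):

* `UniversalFactor.exists_zero_deBruijnH_zero_of_mul_re_neg` — a sign change of the real function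
  `x ↦ H_0(x) = ξ(1/2 + ix/2)/8` between `u ≤ v` produces a zero of `H_0` in `[u, v]` (IVT);
* **`UniversalFactor.not_hasOnlyRealZeros_of_sign_changes`** — if `F_a = deBruijnHDiv (1 + u²/a²)`
  (`a > 0`) has no zero on `[α, β]` while `H_0` changes sign three times there
  (`H_0(x₀)H_0(x₁) < 0`, `H_0(x₁)H_0(x₂) < 0`, `H_0(x₂)H_0(x₃) < 0` at `α ≤ x₀ < x₁ < x₂ < x₃ ≤ β`),
  then `F_a` has a non-real zero.

So refuting `X(a)` for a given `a` costs: one interval on which `F_a` is certified zero-free (e.g.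
`F_a > 0` by interval arithmetic on the convolution `F_a = H_0 ∗ (a/2)e^{−a|·|}`) and four signs of
Hardy's `Z` (`H_0(2t) = −(1/16)(t² + 1/4)π^{−1/4}|Γ(1/4 + it/2)| Z(t)`).
-/

noncomputable section

namespace Summit.RiemannHypothesis.RiemannHypothesis.Theorems

open Set Complex
open Literature.NumberTheory.LFunctions
open Summit.RiemannHypothesis.RiemannHypothesis.Theses

/-- `H_0` is real on the real axis. [folklore] -/
theorem UniversalFactor.deBruijnH_zero_ofReal_im (x : ℝ) : (deBruijnH 0 x).im = 0 := by
  rw [← deBruijnHDiv_one']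
  exact deBruijnHDiv_ofReal_im _ x

/-- `x ↦ Re H_0(x)` is continuous on `ℝ`. [folklore] -/
theorem UniversalFactor.continuous_re_deBruijnH_zero_ofReal :
    Continuous fun x : ℝ => (deBruijnH 0 x).re :=
  Complex.continuous_re.comp
    ((differentiable_deBruijnH_holds 0).continuous.comp Complex.continuous_ofReal)

/-- **IVT for `H_0` on the real axis**: if `Re H_0(u) · Re H_0(v) < 0` with `u ≤ v` then `H_0` has a
zero in `[u, v]`, and it is neither `u` nor `v`. [folklore] -/
theorem UniversalFactor.exists_zero_deBruijnH_zero_of_mul_re_neg {u v : ℝ} (huv : u ≤ v)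
    (hs : (deBruijnH 0 u).re * (deBruijnH 0 v).re < 0) :
    ∃ x : ℝ, u < x ∧ x < v ∧ deBruijnH 0 x = 0 := by
  have hcont := UniversalFactor.continuous_re_deBruijnH_zero_ofReal.continuousOn (s := Icc u v)
  have hzero_of_re : ∀ x : ℝ, (deBruijnH 0 x).re = 0 → deBruijnH 0 x = 0 := fun x hx =>
    Complex.ext (by simpa using hx) (by simpa using UniversalFactor.deBruijnH_zero_ofReal_im x)
  have hu0 : (deBruijnH 0 u).re ≠ 0 := fun h => by rw [h, zero_mul] at hs; exact lt_irrefl _ hs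
  have hv0 : (deBruijnH 0 v).re ≠ 0 := fun h => by rw [h, mul_zero] at hs; exact lt_irrefl _ hs
  obtain ⟨x, hxI, hx0⟩ : ∃ x ∈ Icc u v, (deBruijnH 0 x).re = 0 := by
    rcases mul_neg_iff.1 hs with ⟨hu, hv⟩ | ⟨hu, hv⟩
    · exact intermediate_value_Icc' huv hcont ⟨hv.le, hu.le⟩
    · exact intermediate_value_Icc huv hcont ⟨hu.le, hv.le⟩
  refine ⟨x, lt_of_le_of_ne hxI.1 ?_, lt_of_le_of_ne hxI.2 ?_, hzero_of_re x hx0⟩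
  · rintro rfl; exact hu0 hx0
  · rintro rfl; exact hv0 hx0

/-- **The sign criterion** (route `UniversalFactor`, against the target `LaplaceLoophole`): let
`a > 0` and `α ≤ x₀ < x₁ < x₂ < x₃ ≤ β`. If `F_a = deBruijnHDiv (1 + u²/a²)` has no zero on `[α, β]`
and `H_0 = ξ(1/2 + ix/2)/8` changes sign on each of `[x₀, x₁]`, `[x₁, x₂]`, `[x₂, x₃]`, then `F_a`
has a non-real zero. (IVT gives three zeros of `H_0` in `[α, β]`, impossible under `X(a)` by
`UniversalFactor.not_three_zeros_of_zeroFree`.) [folklore] -/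
theorem UniversalFactor.not_hasOnlyRealZeros_of_sign_changes {a : ℝ} (ha : 0 < a)
    {α β x₀ x₁ x₂ x₃ : ℝ} (h0 : α ≤ x₀) (h01 : x₀ < x₁) (h12 : x₁ < x₂) (h23 : x₂ < x₃)
    (h3 : x₃ ≤ β)
    (hs₁ : (deBruijnH 0 x₀).re * (deBruijnH 0 x₁).re < 0)
    (hs₂ : (deBruijnH 0 x₁).re * (deBruijnH 0 x₂).re < 0)
    (hs₃ : (deBruijnH 0 x₂).re * (deBruijnH 0 x₃).re < 0)
    (hF : ∀ x ∈ Icc α β, deBruijnHDiv (fun u : ℝ => 1 + u ^ 2 / a ^ 2) x ≠ 0) :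
    ¬ HasOnlyRealZeros (deBruijnHDiv fun u : ℝ => 1 + u ^ 2 / a ^ 2) := by
  intro hX
  obtain ⟨z₁, hz₁l, hz₁r, hz₁⟩ := UniversalFactor.exists_zero_deBruijnH_zero_of_mul_re_neg h01.le hs₁
  obtain ⟨z₂, hz₂l, hz₂r, hz₂⟩ := UniversalFactor.exists_zero_deBruijnH_zero_of_mul_re_neg h12.le hs₂
  obtain ⟨z₃, hz₃l, hz₃r, hz₃⟩ := UniversalFactor.exists_zero_deBruijnH_zero_of_mul_re_neg h23.le hs₃
  exact UniversalFactor.not_three_zeros_of_zeroFree ha hX hF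
    ⟨h0.trans hz₁l.le, by linarith⟩ ⟨by linarith, hz₃r.le.trans h3⟩
    (hz₁r.trans hz₂l) (hz₂r.trans hz₃l) hz₁ hz₂ hz₃

/-- The sign criterion in the route's inlined notation (the target's function verbatim). [folklore] -/
theorem UniversalFactor.not_hasOnlyRealZeros_laplace_of_sign_changes {a : ℝ} (ha : 0 < a)
    {α β x₀ x₁ x₂ x₃ : ℝ} (h0 : α ≤ x₀) (h01 : x₀ < x₁) (h12 : x₁ < x₂) (h23 : x₂ < x₃)
    (h3 : x₃ ≤ β)
    (hs₁ : (deBruijnH 0 x₀).re * (deBruijnH 0 x₁).re < 0)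
    (hs₂ : (deBruijnH 0 x₁).re * (deBruijnH 0 x₂).re < 0)
    (hs₃ : (deBruijnH 0 x₂).re * (deBruijnH 0 x₃).re < 0)
    (hF : ∀ x ∈ Icc α β,
      (∫ u in Set.Ioi (0:ℝ), ((deBruijnPhi u / (1 + u ^ 2 / a ^ 2) : ℝ) : ℂ) *
        Complex.cos ((x : ℂ) * u)) ≠ 0) :
    ¬ HasOnlyRealZeros (fun z : ℂ => ∫ u in Set.Ioi (0:ℝ),
        ((deBruijnPhi u / (1 + u ^ 2 / a ^ 2) : ℝ) : ℂ) * Complex.cos (z * u)) :=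
  UniversalFactor.not_hasOnlyRealZeros_of_sign_changes ha h0 h01 h12 h23 h3 hs₁ hs₂ hs₃ hF

end Summit.RiemannHypothesis.RiemannHypothesis.Theorems
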